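import Mathlib
import Literature.MathematicalPhysics.QuantumFieldTheory.Balaban1983to89.B2LargeField

/-!
# `Balaban1983to89.B2Eq29Resummation` — T. Bałaban, *(Higgs)₂,₃ quantum fields in a finite volume. II. An upper
bound*, Commun. Math. Phys. **86** (1982) 555–594 [Balaban1982Higgs2]: the partial resummation (2.9) and the
expansion (2.10) p. 558 of the large-field/small-field partition of unity (2.6) over the admissible 6-tuples
{P_v, Q_v, R_v, P_s, Q_s, R_s} belonging to a fixed small-field region Λ₀

statement-level skeleton of published theorems with citation tags; proofs where landed; nothing here is a claim about the Yang–Mills mass gap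

PDF held: `paper:balaban1982-cmp86-higgs23-ii` (journal page = PDF page + 554); (2.6)–(2.10) read from the ×2 render
`run/shared/lean/pub/pub-balaban/b2b-balaban-ref1/pages/1982-cmp86-higgs23-II/1982-cmp86-higgs23-II-p004-x2.png`
(p. 558) and (2.2)–(2.5) from `…-p003-x2.png` (p. 557).

WHAT IS REPRODUCED.  SKELETON row **B2.Eq2.9** ((2.9)–(2.10) p. 558; fold owner r02, status before this file: `absent
(combinatorial identity "It is easily seen")`).  (2.9) and (2.10) are TYPED AS PRINTED over an abstract
site/large-block dictionary (`Eq29Printed`, `Eq210Printed`); the resummation is PROVED as an INEQUALITY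
(`lhs29_le_rhs29`: left side of (2.9) ≤ right side; `one_le_sum_rhs29`: 1 ≤ Σ_{Λ₀}[right side of (2.9)], the form
of (2.10) an upper bound uses), the Λ₀-grouping of (2.6) that precedes (2.9) is PROVED (`sum_lhs29_eq_one`:
Σ_{Λ₀} Σ_{admissible} … = 1), the closed form of the resummed block over one minimal tuple is PROVED
(`sum_interval_term`), and the printed EQUALITY SIGNS are REFUTED (`not_eq29Printed_of_two_sites`,
`not_eq210Printed_of_two_sites`, with the fully concrete instance `not_eq29Printed_fin2`): the right side of (2.9)
counts a field configuration once for EVERY minimal admissible tuple lying below its tuple of large-field sets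
(`rhs29_eq_sum_count`), so "=" in (2.9) holds exactly when Λ₀ admits at most one minimal admissible tuple
(`lhs29_eq_rhs29_of_subsingleton`) and is strict otherwise (`lhs29_lt_rhs29`); two distinct elements with the same
r(ε)-neighbourhood of large blocks (e.g. two of the 2d bonds at one point carrying a large |∂A|, away from the
distance thresholds of the large-block grid) already give two minimal tuples.  The overcount is HARMLESS for the
upper bound of the paper, which only ever uses (2.9)/(2.10) from above (every term is non-negative) — recorded in
HOME/GAPS.md, not repaired in anybody else's file.  KERNEL: finite sums/products over `Finset`, Mathlib's `Minimal`
and well-foundedness of `⊂` on finite sets; no measure theory.  NOT HERE: the integrand of (2.1) and the objects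
ζ_{Λ₀} of (2.15) (row B2.Eq2.15), the regions Λ₁, Λ₂, … of (2.8) (typed in `B2LargeField`), any claim about which
large/small patterns the Higgs fields realise.

Unit `lit-balaban-r14` gen 3 (reader/typer of B1–B2), HOME `run/shared/lean/pub/lit-balaban/` (ROWS-B2 second-reader
addendum `lit-balaban-r14/ROWS-B2.md`).

THE SOURCE TEXT, verbatim (p. 558 [PDF 4]).  *"Unifying these two expansions, i.e. multiplying (2.4) and (2.5), we get
a joint expansion: 1 = Σ_{P_v,P_s⊂T′₁} Σ_{Q_v,Q_s⊂T*₁} Σ_{R_v,R_s⊂T₁} χ^c_{P_v}χ_{P_v^c}χ^c_{P_s}χ_{P_s^c} ·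
χ^c_{Q_v}χ_{Q_v^c}χ^c_{Q_s}χ_{Q_s^c}χ^c_{R_v}χ_{R_v^c}χ^c_{R_s}χ_{R_s^c}. (2.6) … Let us define: Λ₀^c is the sum of all
large blocks of T₁ distant from one of the sets B(P_v), Q_v, R_v, B(P_s), Q_s, R_s less than r(ε) = R(1 + log ε⁻¹)^r.
… (2.7) … Of course all the fields are small on the set Λ₀ and on the neighbourhood of Λ₀ of the additional thickness
r(ε) also. In (2.6) some terms have a set Λ₀ in common, so we can represent this sum as the sum over all possible
sets Λ₀, and next for each fixed Λ₀ we have a sum over all admissible sets P_v, …, R_s, i.e. defining the set Λ₀^c by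
(2.7). In this last sum we can make a partial resummation. In the class of ordered 6-tuples {P_v, Q_v, R_v, P_s,
Q_s, R_s} the inclusion relation between the proper sets defines a natural partial order relation. Thus, there are
minimal elements in the class. Let us denote by Λ^{(*,′)}_{−1} the set of the points (the bonds, the blocks) in T₁
distant from Λ₀ less than r(ε). It is easily seen that
Σ_{{P_v,…,R_s} admissible} χ^c_{P_v}χ_{P_v^c}·…·χ^c_{R_s}χ_{R_s^c}
  = Σ_{{P_v,…,R_s} admissible, minimal} χ^c_{P_v}χ^c_{P_s}χ^c_{Q_v}χ^c_{Q_s}χ^c_{R_v}χ^c_{R_s}χ_{Λ_{−1}}, (2.9)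
where the last characteristic function denotes the product of the characteristic functions giving the corresponding
restrictions on the vector and the scalar fields on the set Λ′_{−1}, Λ*_{−1}, Λ_{−1}. Let us notice that the minimal
elements are the elements for which the sets P_v, …, R_s are maximally "diluted." For example, this implies that
each pair of elements belonging to the sum of these sets has a distance > r(ε). Further we have
1 = Σ_{Λ₀} [the expression on the right side of (2.9)]. (2.10)
The above expansion is introduced under the integral (2.1) and we get a sum of terms."*

DICTIONARY (abstract ↤ printed).  `S` ↤ the disjoint union T′₁ ⊔ T*₁ ⊔ T₁ ⊔ T′₁ ⊔ T*₁ ⊔ T₁ of the six index sets of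
(2.6): an ordered 6-tuple {P_v, …, R_s} IS a subset `τ : Finset S` and the componentwise "inclusion relation between
the proper sets" IS `⊆` on `Finset S`; `β` ↤ the set of large blocks of T₁ (part I (1.20)); `N x : Finset β` ↤ the
large blocks "distant from" the element x (the block B(y) for y ∈ P_v ∪ P_s, the bond for Q, the point for R) "less
than r(ε)", so that Λ₀^c of (2.7) for the tuple τ is `nbhd N τ = ⋃_{x∈τ} N x` (bridge to the (2.7) typing
`B2LargeField.lambda0Compl` over real distances: `coe_nbhd_eq_lambda0Compl`); `W : Finset β` ↤ Λ₀^c for the fixed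
Λ₀; "admissible" ↤ `Admissible N W τ :↔ nbhd N τ = W` (*"defining the set Λ₀^c by (2.7)"*); "minimal" ↤ Mathlib's
`Minimal (Admissible N W) τ` (minimal for `⊆` in the class of admissible tuples); Λ_{−1} (all three sorts Λ′_{−1},
Λ*_{−1}, Λ_{−1} at once) ↤ `inner N W = {x | ¬ N x ⊆ W}` (x lies within r(ε) of Λ₀ = ⋃(large blocks ∉ W) iff some
large block outside W lies within r(ε) of x — the block distance of (2.7)); its complement `outer N W = {x | N x ⊆ W}`;
`c x`, `s x : ℝ` ↤ the values of the indicators χ^c (one of the inequalities (2.2) holds at x: "large") and χ (its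
negation: "small") at x on a given field configuration, χ^c + χ = 1 (`B2LargeField.indicator_add_compl`);
`term c s τ` ↤ the summand χ^c_{P_v}χ_{P_v^c}·…·χ^c_{R_s}χ_{R_s^c} of (2.6)/(2.9)-left for the tuple τ; χ_{Λ_{−1}} ↤
`∏ x ∈ inner N W, s x`; Σ_{Λ₀} ↤ the sum over `regions N` = all values Λ₀^c(τ) (other Λ₀ contribute empty sums).
-/

namespace Literature.MathematicalPhysics.QuantumFieldTheory.Balaban1983to89.B2Eq29Resummation

open Finset
open scoped Classical

noncomputable section

variable {S β : Type*}

/-! ## The dictionary: Λ₀^c(τ) of (2.7), admissible and minimal tuples, Λ_{−1}, the summands of (2.6)/(2.9) -/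

/-- Λ₀^c of the tuple τ, (2.7) p. 558 read blockwise: *"Λ₀^c is the sum of all large blocks of T₁ distant from one of
the sets B(P_v), Q_v, R_v, B(P_s), Q_s, R_s less than r(ε)"* = the union over the elements x of the tuple of the sets
`N x` of large blocks lying within r(ε) of x. [cite: Balaban1982Higgs2, (2.7) p.558] -/
def nbhd (N : S → Finset β) (τ : Finset S) : Finset β := τ.biUnion N

/-- Unfolding (definitional). [cite: Balaban1982Higgs2, (2.7) p.558] -/
theorem nbhd_def (N : S → Finset β) (τ : Finset S) : nbhd N τ = τ.biUnion N := rfl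

/-- Membership in Λ₀^c(τ): some element of the tuple is r(ε)-close to the block. [cite: Balaban1982Higgs2, (2.7) p.558] -/
theorem mem_nbhd {N : S → Finset β} {τ : Finset S} {b : β} : b ∈ nbhd N τ ↔ ∃ x ∈ τ, b ∈ N x := by
  simp [nbhd]

/-- Λ₀^c grows with the tuple (the "inclusion relation between the proper sets" is respected).
[cite: Balaban1982Higgs2, (2.7) p.558] -/
theorem nbhd_mono (N : S → Finset β) {τ τ' : Finset S} (h : τ ⊆ τ') : nbhd N τ ⊆ nbhd N τ' :=
  Finset.biUnion_subset_biUnion_of_subset_left N h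

/-- The neighbourhood of one element is in Λ₀^c of any tuple containing it. [cite: Balaban1982Higgs2, (2.7) p.558] -/
theorem subset_nbhd_of_mem (N : S → Finset β) {τ : Finset S} {x : S} (hx : x ∈ τ) : N x ⊆ nbhd N τ :=
  Finset.subset_biUnion_of_mem N hx

/-- The empty tuple has empty Λ₀^c (Λ₀ = T₁). [cite: Balaban1982Higgs2, (2.7) p.558] -/
theorem nbhd_empty (N : S → Finset β) : nbhd N ∅ = ∅ := by simp [nbhd]

/-- A one-element tuple: Λ₀^c = the neighbourhood of that element. [cite: Balaban1982Higgs2, (2.7) p.558] -/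
theorem nbhd_singleton (N : S → Finset β) (x : S) : nbhd N {x} = N x := by simp [nbhd]

/-- BRIDGE to the (2.7) typing of `B2LargeField` (sets of blocks, real-valued block distances `bdist`, radius r =
r(ε)): when `N x` is the finset of blocks at distance < r from x, `nbhd N τ` is exactly `B2LargeField.lambda0Compl`
for the bad set τ. [cite: Balaban1982Higgs2, (2.7) p.558] -/
theorem coe_nbhd_eq_lambda0Compl [Fintype β] (bdist : β → S → ℝ) (r : ℝ) (τ : Finset S) :
    (↑(nbhd (fun x => Finset.univ.filter fun b => bdist b x < r) τ) : Set β)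
      = B2LargeField.lambda0Compl bdist (↑τ : Set S) r := by
  ext b
  simp only [Finset.mem_coe, mem_nbhd, Finset.mem_filter, Finset.mem_univ, true_and,
    B2LargeField.lambda0Compl, Set.mem_setOf_eq]

/-- *"for each fixed Λ₀ we have a sum over all admissible sets P_v, …, R_s, i.e. defining the set Λ₀^c by (2.7)"*:
the tuple τ is admissible for W = Λ₀^c iff its Λ₀^c is W. [cite: Balaban1982Higgs2, (2.9) p.558] -/
def Admissible (N : S → Finset β) (W : Finset β) (τ : Finset S) : Prop := nbhd N τ = W

/-- Unfolding (definitional). [cite: Balaban1982Higgs2, (2.9) p.558] -/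
theorem admissible_iff_eq {N : S → Finset β} {W : Finset β} {τ : Finset S} :
    Admissible N W τ ↔ nbhd N τ = W := Iff.rfl

/-- *"Thus, there are minimal elements in the class"*: below every admissible tuple there is a minimal admissible one
(well-foundedness of ⊂ on finite sets; "minimal" = Mathlib's `Minimal` for ⊆). [cite: Balaban1982Higgs2, (2.9) p.558] -/
theorem exists_minimal_subset {N : S → Finset β} {W : Finset β} {τ : Finset S} (h : Admissible N W τ) :
    ∃ m, m ⊆ τ ∧ Minimal (Admissible N W) m :=
  exists_minimal_le_of_wellFoundedLT (Admissible N W) τ h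

/-- A minimal admissible tuple loses admissibility when any proper sub-tuple is taken ("maximally diluted").
[cite: Balaban1982Higgs2, (2.9) p.558] -/
theorem minimal_iff_forall_ssubset {N : S → Finset β} {W : Finset β} {τ : Finset S} :
    Minimal (Admissible N W) τ ↔ Admissible N W τ ∧ ∀ ⦃τ'⦄, τ' ⊂ τ → ¬Admissible N W τ' :=
  minimal_iff_forall_lt

/-- A one-element tuple {x} with N x = W is a MINIMAL admissible tuple as soon as W ≠ ∅ (in the paper every
neighbourhood contains the element's own large block, so W ≠ ∅ always). [cite: Balaban1982Higgs2, (2.9) p.558] -/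
theorem minimal_singleton {N : S → Finset β} {W : Finset β} {x : S} (hx : N x = W) (hW : W.Nonempty) :
    Minimal (Admissible N W) {x} := by
  refine minimal_iff_forall_ssubset.2 ⟨?_, ?_⟩
  · simpa [Admissible, nbhd_singleton] using hx
  · intro τ' hτ'
    have hτ'e : τ' = ∅ := Finset.ssubset_singleton_iff.1 hτ'
    subst hτ'e
    simp only [Admissible, nbhd_empty]
    intro h
    exact hW.ne_empty h.symm

variable [Fintype S]

/-- The elements at distance ≥ r(ε) from Λ₀, i.e. whose own neighbourhood of large blocks stays inside W = Λ₀^c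
(the complement of Λ_{−1}). [cite: Balaban1982Higgs2, (2.9) p.558] -/
def outer (N : S → Finset β) (W : Finset β) : Finset S := Finset.univ.filter fun x => N x ⊆ W

/-- Λ_{−1} = Λ′_{−1} ∪ Λ*_{−1} ∪ Λ_{−1} of p. 558: *"the set of the points (the bonds, the blocks) in T₁ distant from Λ₀
less than r(ε)"* — x is r(ε)-close to Λ₀ = ⋃(large blocks outside W) iff some block of `N x` lies outside W.
[cite: Balaban1982Higgs2, (2.9) p.558] -/
def inner (N : S → Finset β) (W : Finset β) : Finset S := Finset.univ.filter fun x => ¬N x ⊆ W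

/-- Membership in the outer region. [cite: Balaban1982Higgs2, (2.9) p.558] -/
theorem mem_outer {N : S → Finset β} {W : Finset β} {x : S} : x ∈ outer N W ↔ N x ⊆ W := by
  simp [outer]

/-- Membership in Λ_{−1}. [cite: Balaban1982Higgs2, (2.9) p.558] -/
theorem mem_inner {N : S → Finset β} {W : Finset β} {x : S} : x ∈ inner N W ↔ ¬N x ⊆ W := by
  simp [inner]

/-- Λ_{−1} is the complement of the outer region. [cite: Balaban1982Higgs2, (2.9) p.558] -/
theorem inner_eq_compl_outer (N : S → Finset β) (W : Finset β) : inner N W = (outer N W)ᶜ := by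
  ext x
  simp [inner, outer]

/-- CHARACTERISATION of admissibility: τ is admissible for W iff every element of τ keeps its neighbourhood inside
W (τ avoids Λ_{−1}: *"all the fields are small … on the neighbourhood of Λ₀ of the additional thickness r(ε)"*) and
the neighbourhoods of τ cover W. [cite: Balaban1982Higgs2, (2.9) p.558] -/
theorem admissible_iff {N : S → Finset β} {W : Finset β} {τ : Finset S} :
    Admissible N W τ ↔ τ ⊆ outer N W ∧ W ⊆ nbhd N τ := by
  constructor
  · intro h
    refine ⟨fun x hx => mem_outer.2 (h ▸ subset_nbhd_of_mem N hx), h ▸ Finset.Subset.refl _⟩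
  · rintro ⟨h₁, h₂⟩
    refine Finset.Subset.antisymm ?_ h₂
    intro b hb
    obtain ⟨x, hx, hbx⟩ := mem_nbhd.1 hb
    exact mem_outer.1 (h₁ hx) hbx

/-- An admissible tuple lies in the outer region. [cite: Balaban1982Higgs2, (2.9) p.558] -/
theorem Admissible.subset_outer {N : S → Finset β} {W : Finset β} {τ : Finset S} (h : Admissible N W τ) :
    τ ⊆ outer N W :=
  (admissible_iff.1 h).1

/-- The admissible tuples form an UP-SET inside the outer region: anything between an admissible tuple and the outer
region is admissible (this is what makes the block resummation of (2.9) possible). [cite: Balaban1982Higgs2, (2.9) p.558] -/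
theorem Admissible.of_subset_of_subset_outer {N : S → Finset β} {W : Finset β} {m τ : Finset S}
    (hm : Admissible N W m) (hmτ : m ⊆ τ) (hτ : τ ⊆ outer N W) : Admissible N W τ :=
  admissible_iff.2 ⟨hτ, (admissible_iff.1 hm).2.trans (nbhd_mono N hmτ)⟩

/-- The summand of (2.6) (and of the left side of (2.9)) for the tuple τ on a given field configuration:
Π_{x∈τ} χ^c_x · Π_{x∉τ} χ_x. [cite: Balaban1982Higgs2, (2.6) p.558] -/
def term (c s : S → ℝ) (τ : Finset S) : ℝ := (∏ x ∈ τ, c x) * ∏ x ∈ τᶜ, s x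

/-- Unfolding (definitional). [cite: Balaban1982Higgs2, (2.6) p.558] -/
theorem term_def (c s : S → ℝ) (τ : Finset S) : term c s τ = (∏ x ∈ τ, c x) * ∏ x ∈ τᶜ, s x := rfl

/-- Non-negative indicators give non-negative summands. [cite: Balaban1982Higgs2, (2.6) p.558] -/
theorem term_nonneg {c s : S → ℝ} (hc : ∀ x, 0 ≤ c x) (hs : ∀ x, 0 ≤ s x) (τ : Finset S) : 0 ≤ term c s τ :=
  mul_nonneg (Finset.prod_nonneg fun x _ => hc x) (Finset.prod_nonneg fun x _ => hs x)

/-- **(2.6)** p. 558 in the dictionary (one sum over all tuples τ ⊆ S = all ordered 6-tuples): Σ_τ Π_{x∈τ}χ^c_x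
Π_{x∉τ}χ_x = 1 whenever χ^c + χ = 1 pointwise — r14's `B2LargeField.sum_powerset_prod_eq_one` on the whole index
set. [cite: Balaban1982Higgs2, (2.6) p.558] -/
theorem sum_term_eq_one {c s : S → ℝ} (h1 : ∀ x, c x + s x = 1) : ∑ τ, term c s τ = 1 := by
  have h := B2LargeField.sum_powerset_prod_eq_one (Finset.univ : Finset S) c s fun x _ => h1 x
  rw [Finset.powerset_univ] at h
  simpa [term, Finset.compl_eq_univ_sdiff] using h

/-- The admissible tuples for W = Λ₀^c (the index set of the left side of (2.9)). [cite: Balaban1982Higgs2, (2.9) p.558] -/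
def admissibles (N : S → Finset β) (W : Finset β) : Finset (Finset S) :=
  Finset.univ.filter (Admissible N W)

/-- The minimal admissible tuples for W (the index set of the right side of (2.9)). [cite: Balaban1982Higgs2, (2.9) p.558] -/
def minimals (N : S → Finset β) (W : Finset β) : Finset (Finset S) :=
  Finset.univ.filter (Minimal (Admissible N W))

/-- Membership. [cite: Balaban1982Higgs2, (2.9) p.558] -/
theorem mem_admissibles {N : S → Finset β} {W : Finset β} {τ : Finset S} :
    τ ∈ admissibles N W ↔ Admissible N W τ := by
  simp [admissibles]

/-- Membership. [cite: Balaban1982Higgs2, (2.9) p.558] -/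
theorem mem_minimals {N : S → Finset β} {W : Finset β} {τ : Finset S} :
    τ ∈ minimals N W ↔ Minimal (Admissible N W) τ := by
  simp [minimals]

/-- The LEFT side of (2.9): Σ over the admissible tuples of χ^c_{P_v}χ_{P_v^c}·…·χ^c_{R_s}χ_{R_s^c}.
[cite: Balaban1982Higgs2, (2.9) p.558] -/
def lhs29 (N : S → Finset β) (W : Finset β) (c s : S → ℝ) : ℝ :=
  ∑ τ ∈ admissibles N W, term c s τ

/-- The RIGHT side of (2.9): Σ over the minimal admissible tuples of χ^c_{P_v}χ^c_{P_s}χ^c_{Q_v}χ^c_{Q_s}χ^c_{R_v}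
χ^c_{R_s} · χ_{Λ_{−1}}. [cite: Balaban1982Higgs2, (2.9) p.558] -/
def rhs29 (N : S → Finset β) (W : Finset β) (c s : S → ℝ) : ℝ :=
  ∑ τ ∈ minimals N W, (∏ x ∈ τ, c x) * ∏ x ∈ inner N W, s x

/-- **(2.9) AS PRINTED** (with "="), for the neighbourhood data N and the region W = Λ₀^c: the identity is claimed
for every field configuration, i.e. for all {0,1}-valued indicator weights with χ^c + χ = 1.  REFUTED below
(`not_eq29Printed_of_two_sites`) whenever W admits two minimal admissible tuples; the true statement is
`lhs29_le_rhs29` (and `lhs29_eq_rhs29_of_subsingleton`). [cite: Balaban1982Higgs2, (2.9) p.558] -/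
def Eq29Printed (N : S → Finset β) (W : Finset β) : Prop :=
  ∀ c s : S → ℝ, (∀ x, c x = 0 ∨ c x = 1) → (∀ x, c x + s x = 1) → lhs29 N W c s = rhs29 N W c s

/-! ## The resummation mechanism: summing the (2.6)-summands over an interval [m, G] of tuples -/

/-- THE BLOCK RESUMMATION behind (2.9): for m ⊆ G, summing the (2.6)-summands over all tuples τ with m ⊆ τ ⊆ G
binomially collapses the free elements x ∈ G ∖ m (factor χ^c_x + χ_x = 1) and leaves Π_{x∈m}χ^c_x · Π_{x∉G}χ_x.  With
m a minimal admissible tuple and G = `outer N W` (so that Gᶜ = Λ_{−1}) this is exactly the m-summand of the right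
side of (2.9). [cite: Balaban1982Higgs2, (2.9) p.558] -/
theorem sum_interval_term {c s : S → ℝ} (h1 : ∀ x, c x + s x = 1) {m G : Finset S} (hmG : m ⊆ G) :
    ∑ τ ∈ Finset.univ.filter (fun τ : Finset S => m ⊆ τ ∧ τ ⊆ G), term c s τ
      = (∏ x ∈ m, c x) * ∏ x ∈ Gᶜ, s x := by
  -- modified weights: c' kills tuples leaving G, s' kills tuples missing part of m
  set c' : S → ℝ := fun x => if x ∈ G then c x else 0 with hc'
  set s' : S → ℝ := fun x => if x ∈ m then 0 else s x with hs'
  -- (i) the full binomial sum of the modified summands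
  have hfull : ∑ τ, term c' s' τ = ∏ x, (c' x + s' x) := by
    have h := Finset.prod_add c' s' (Finset.univ : Finset S)
    rw [Finset.powerset_univ] at h
    simpa [term, Finset.compl_eq_univ_sdiff] using h.symm
  -- (ii) the product of the modified weights
  have hprod : ∏ x, (c' x + s' x) = (∏ x ∈ m, c x) * ∏ x ∈ Gᶜ, s x := by
    rw [← Finset.prod_mul_prod_compl G, ← Finset.prod_sdiff hmG]
    have hGm : ∏ x ∈ G \ m, (c' x + s' x) = 1 := by
      refine Finset.prod_eq_one fun x hx => ?_
      rw [Finset.mem_sdiff] at hx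
      simp [hc', hs', hx.1, hx.2, h1 x]
    have hm : ∏ x ∈ m, (c' x + s' x) = ∏ x ∈ m, c x := by
      refine Finset.prod_congr rfl fun x hx => ?_
      simp [hc', hs', hx, hmG hx]
    have hGc : ∏ x ∈ Gᶜ, (c' x + s' x) = ∏ x ∈ Gᶜ, s x := by
      refine Finset.prod_congr rfl fun x hx => ?_
      rw [Finset.mem_compl] at hx
      have hxm : x ∉ m := fun h => hx (hmG h)
      simp [hc', hs', hx, hxm]
    rw [hGm, hm, hGc, one_mul]
  -- (iii) the modified summand is the original one on the interval and 0 outside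
  have hterm : ∀ τ : Finset S, term c' s' τ = if m ⊆ τ ∧ τ ⊆ G then term c s τ else 0 := by
    intro τ
    split_ifs with hτ
    · obtain ⟨hmτ, hτG⟩ := hτ
      have hcτ : ∏ x ∈ τ, c' x = ∏ x ∈ τ, c x :=
        Finset.prod_congr rfl fun x hx => by simp [hc', hτG hx]
      have hsτ : ∏ x ∈ τᶜ, s' x = ∏ x ∈ τᶜ, s x :=
        Finset.prod_congr rfl fun x hx => by
          rw [Finset.mem_compl] at hx
          have hxm : x ∉ m := fun h => hx (hmτ h)
          simp [hs', hxm]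
      rw [term, term, hcτ, hsτ]
    · rw [not_and_or] at hτ
      rcases hτ with hmτ | hτG
      · obtain ⟨x, hxm, hxτ⟩ := Finset.not_subset.1 hmτ
        have hz : ∏ y ∈ τᶜ, s' y = 0 :=
          Finset.prod_eq_zero (Finset.mem_compl.2 hxτ) (by simp [hs', hxm])
        rw [term, hz, mul_zero]
      · obtain ⟨x, hxτ, hxG⟩ := Finset.not_subset.1 hτG
        have hz : ∏ y ∈ τ, c' y = 0 := Finset.prod_eq_zero hxτ (by simp [hc', hxG])
        rw [term, hz, zero_mul]
  -- assemble
  rw [Finset.sum_filter, ← hprod, ← hfull]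
  exact Finset.sum_congr rfl fun τ _ => (hterm τ).symm

/-- The number of minimal admissible tuples below τ — the multiplicity with which the right side of (2.9) counts
the configuration whose tuple of large-field sets is τ. [cite: Balaban1982Higgs2, (2.9) p.558] -/
def count (N : S → Finset β) (W : Finset β) (τ : Finset S) : ℕ := ((minimals N W).filter fun m => m ⊆ τ).card

/-- Below an admissible tuple there is at least one minimal admissible tuple. [cite: Balaban1982Higgs2, (2.9) p.558] -/
theorem one_le_count {N : S → Finset β} {W : Finset β} {τ : Finset S} (h : Admissible N W τ) : 1 ≤ count N W τ := by
  obtain ⟨m, hmτ, hm⟩ := exists_minimal_subset h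
  refine Finset.card_pos.2 ⟨m, ?_⟩
  exact Finset.mem_filter.2 ⟨mem_minimals.2 hm, hmτ⟩

/-- A tuple inside the outer region lying above some minimal admissible tuple is admissible; contrapositively a
non-admissible τ ⊆ outer has count 0. [cite: Balaban1982Higgs2, (2.9) p.558] -/
theorem count_eq_zero {N : S → Finset β} {W : Finset β} {τ : Finset S} (hτ : τ ⊆ outer N W)
    (h : ¬Admissible N W τ) : count N W τ = 0 := by
  rw [count, Finset.card_eq_zero, Finset.filter_eq_empty_iff]
  intro m hm hmτ
  exact h ((mem_minimals.1 hm).prop.of_subset_of_subset_outer hmτ hτ)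

/-- If W admits at most one minimal admissible tuple, every admissible τ has count exactly 1.
[cite: Balaban1982Higgs2, (2.9) p.558] -/
theorem count_eq_one {N : S → Finset β} {W : Finset β}
    (hsub : ∀ m₁ m₂, Minimal (Admissible N W) m₁ → Minimal (Admissible N W) m₂ → m₁ = m₂) {τ : Finset S}
    (h : Admissible N W τ) : count N W τ = 1 := by
  refine le_antisymm ?_ (one_le_count h)
  rw [count, Finset.card_le_one]
  intro a ha b hb
  exact hsub a b (mem_minimals.1 (Finset.mem_filter.1 ha).1) (mem_minimals.1 (Finset.mem_filter.1 hb).1)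

/-- Two distinct minimal admissible tuples below τ give count ≥ 2. [cite: Balaban1982Higgs2, (2.9) p.558] -/
theorem two_le_count {N : S → Finset β} {W : Finset β} {m₁ m₂ τ : Finset S} (h₁ : Minimal (Admissible N W) m₁)
    (h₂ : Minimal (Admissible N W) m₂) (hne : m₁ ≠ m₂) (h₁τ : m₁ ⊆ τ) (h₂τ : m₂ ⊆ τ) : 2 ≤ count N W τ := by
  rw [count]
  have hsub : ({m₁, m₂} : Finset (Finset S)) ⊆ (minimals N W).filter fun m => m ⊆ τ := by
    intro m hm
    rcases Finset.mem_insert.1 hm with rfl | hm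
    · exact Finset.mem_filter.2 ⟨mem_minimals.2 h₁, h₁τ⟩
    · rw [Finset.mem_singleton] at hm
      subst hm
      exact Finset.mem_filter.2 ⟨mem_minimals.2 h₂, h₂τ⟩
  calc 2 = ({m₁, m₂} : Finset (Finset S)).card := (Finset.card_pair hne).symm
    _ ≤ _ := Finset.card_le_card hsub

/-- DOUBLE COUNTING: the right side of (2.9) equals the sum over the tuples τ of the outer region of
(number of minimal admissible tuples below τ) × (the (2.6)-summand of τ) — each minimal tuple m contributes the
whole interval [m, outer] by `sum_interval_term`. [cite: Balaban1982Higgs2, (2.9) p.558] -/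
theorem rhs29_eq_sum_count (N : S → Finset β) (W : Finset β) {c s : S → ℝ} (h1 : ∀ x, c x + s x = 1) :
    rhs29 N W c s = ∑ τ ∈ (outer N W).powerset, (count N W τ : ℝ) * term c s τ := by
  -- each m-summand of the right side is an interval sum
  have hm : ∀ m ∈ minimals N W, (∏ x ∈ m, c x) * ∏ x ∈ inner N W, s x
      = ∑ τ ∈ (outer N W).powerset, (if m ⊆ τ then term c s τ else 0) := by
    intro m hm
    have hmo : m ⊆ outer N W := (mem_minimals.1 hm).prop.subset_outer
    rw [inner_eq_compl_outer, ← sum_interval_term h1 hmo, Finset.sum_filter, ← Finset.powerset_univ,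
      ← Finset.sum_filter, ← Finset.sum_filter]
    refine Finset.sum_congr ?_ fun _ _ => rfl
    ext τ
    simp [Finset.mem_powerset, and_comm]
  rw [rhs29, Finset.sum_congr rfl hm, Finset.sum_comm]
  refine Finset.sum_congr rfl fun τ _ => ?_
  rw [← Finset.sum_filter, Finset.sum_const, nsmul_eq_mul, count]

/-- The left side of (2.9) in the same coordinates: Σ over τ ⊆ outer of [τ admissible] × (summand of τ).
[cite: Balaban1982Higgs2, (2.9) p.558] -/
theorem lhs29_eq_sum_ite (N : S → Finset β) (W : Finset β) (c s : S → ℝ) :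
    lhs29 N W c s = ∑ τ ∈ (outer N W).powerset, (if Admissible N W τ then term c s τ else 0) := by
  rw [lhs29, ← Finset.sum_filter]
  refine Finset.sum_congr ?_ fun _ _ => rfl
  ext τ
  simp only [mem_admissibles, Finset.mem_filter, Finset.mem_powerset, iff_and_self]
  exact Admissible.subset_outer

/-! ## (2.9): the inequality that holds, the equality case, and the failure of "=" as printed -/

/-- **(2.9), REPAIRED READING (what the upper bound uses), PROVED**: for non-negative indicator weights with
χ^c + χ = 1 the left side of (2.9) is BOUNDED ABOVE by the right side — every admissible tuple lies above at least one
minimal admissible tuple and all summands are ≥ 0. [cite: Balaban1982Higgs2, (2.9) p.558] -/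
theorem lhs29_le_rhs29 (N : S → Finset β) (W : Finset β) {c s : S → ℝ} (hc : ∀ x, 0 ≤ c x) (hs : ∀ x, 0 ≤ s x)
    (h1 : ∀ x, c x + s x = 1) : lhs29 N W c s ≤ rhs29 N W c s := by
  rw [rhs29_eq_sum_count N W h1, lhs29_eq_sum_ite]
  refine Finset.sum_le_sum fun τ _ => ?_
  split_ifs with hτ
  · have h := one_le_count hτ
    calc term c s τ = (1 : ℝ) * term c s τ := (one_mul _).symm
      _ ≤ (count N W τ : ℝ) * term c s τ :=
        mul_le_mul_of_nonneg_right (by exact_mod_cast h) (term_nonneg hc hs τ)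
  · exact mul_nonneg (Nat.cast_nonneg _) (term_nonneg hc hs τ)

/-- **(2.9) holds with "=" when W = Λ₀^c admits AT MOST ONE minimal admissible tuple** (then the admissible tuples
form the single interval [m, outer] and the resummation is exact; no sign hypothesis needed).
[cite: Balaban1982Higgs2, (2.9) p.558] -/
theorem lhs29_eq_rhs29_of_subsingleton (N : S → Finset β) (W : Finset β)
    (hsub : ∀ m₁ m₂, Minimal (Admissible N W) m₁ → Minimal (Admissible N W) m₂ → m₁ = m₂) {c s : S → ℝ}
    (h1 : ∀ x, c x + s x = 1) : lhs29 N W c s = rhs29 N W c s := by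
  rw [rhs29_eq_sum_count N W h1, lhs29_eq_sum_ite]
  refine Finset.sum_congr rfl fun τ hτ => ?_
  rw [Finset.mem_powerset] at hτ
  split_ifs with h
  · rw [count_eq_one hsub h, Nat.cast_one, one_mul]
  · rw [count_eq_zero hτ h, Nat.cast_zero, zero_mul]

/-- **STRICT INEQUALITY in (2.9)**: if some tuple τ of the outer region lies above two distinct minimal admissible
tuples and its summand is positive on the configuration at hand (e.g. the fields are large exactly on τ and small
elsewhere), the right side of (2.9) EXCEEDS the left side. [cite: Balaban1982Higgs2, (2.9) p.558] -/
theorem lhs29_lt_rhs29 (N : S → Finset β) (W : Finset β) {c s : S → ℝ} (hc : ∀ x, 0 ≤ c x) (hs : ∀ x, 0 ≤ s x)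
    (h1 : ∀ x, c x + s x = 1) {τ : Finset S} (hτ : τ ⊆ outer N W) (hcnt : 2 ≤ count N W τ)
    (hpos : 0 < term c s τ) : lhs29 N W c s < rhs29 N W c s := by
  rw [rhs29_eq_sum_count N W h1, lhs29_eq_sum_ite]
  refine Finset.sum_lt_sum (fun σ _ => ?_) ⟨τ, Finset.mem_powerset.2 hτ, ?_⟩
  · split_ifs with hσ
    · calc term c s σ = (1 : ℝ) * term c s σ := (one_mul _).symm
        _ ≤ (count N W σ : ℝ) * term c s σ :=
          mul_le_mul_of_nonneg_right (by exact_mod_cast one_le_count hσ) (term_nonneg hc hs σ)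
    · exact mul_nonneg (Nat.cast_nonneg _) (term_nonneg hc hs σ)
  · have h2 : (2 : ℝ) ≤ count N W τ := by exact_mod_cast hcnt
    split_ifs
    · nlinarith
    · nlinarith

/-- The indicator configuration "large exactly on τ": χ^c = 𝟙_τ, χ = 1 − 𝟙_τ; its (2.6)-summand at τ is 1.
[cite: Balaban1982Higgs2, (2.6) p.558] -/
theorem term_indicator_self (τ : Finset S) :
    term (fun x => if x ∈ τ then (1 : ℝ) else 0) (fun x => if x ∈ τ then (0 : ℝ) else 1) τ = 1 := by
  rw [term]
  have h₁ : ∏ x ∈ τ, (if x ∈ τ then (1 : ℝ) else 0) = 1 :=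
    Finset.prod_eq_one fun x hx => by simp [hx]
  have h₂ : ∏ x ∈ τᶜ, (if x ∈ τ then (0 : ℝ) else 1) = 1 :=
    Finset.prod_eq_one fun x hx => by
      rw [Finset.mem_compl] at hx
      simp [hx]
  rw [h₁, h₂, one_mul]

/-- **(2.9) AS PRINTED IS FALSE whenever W admits two distinct minimal admissible tuples m₁ ≠ m₂**: on the
configuration "large exactly on m₁ ∪ m₂, small elsewhere" the left side is 1·(one admissible tuple) while the right
side counts both m₁ and m₂. [cite: Balaban1982Higgs2, (2.9) p.558] -/
theorem not_eq29Printed_of_two_minimal {N : S → Finset β} {W : Finset β} {m₁ m₂ : Finset S}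
    (h₁ : Minimal (Admissible N W) m₁) (h₂ : Minimal (Admissible N W) m₂) (hne : m₁ ≠ m₂) :
    ¬Eq29Printed N W := by
  intro hEq
  set τ : Finset S := m₁ ∪ m₂ with hτdef
  have hτo : τ ⊆ outer N W := Finset.union_subset h₁.prop.subset_outer h₂.prop.subset_outer
  set c : S → ℝ := fun x => if x ∈ τ then 1 else 0 with hcdef
  set s : S → ℝ := fun x => if x ∈ τ then 0 else 1 with hsdef
  have hc01 : ∀ x, c x = 0 ∨ c x = 1 := fun x => by by_cases hx : x ∈ τ <;> simp [hcdef, hx]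
  have hcs : ∀ x, c x + s x = 1 := fun x => by by_cases hx : x ∈ τ <;> simp [hcdef, hsdef, hx]
  have hc : ∀ x, 0 ≤ c x := fun x => by by_cases hx : x ∈ τ <;> simp [hcdef, hx]
  have hs : ∀ x, 0 ≤ s x := fun x => by by_cases hx : x ∈ τ <;> simp [hsdef, hx]
  have hlt := lhs29_lt_rhs29 N W hc hs hcs hτo
    (two_le_count h₁ h₂ hne Finset.subset_union_left Finset.subset_union_right)
    (by rw [term_indicator_self]; exact one_pos)
  exact absurd (hEq c s hc01 hcs) (ne_of_lt hlt)

/-- **(2.9) AS PRINTED IS FALSE as soon as two distinct elements x₁ ≠ x₂ have the same non-empty neighbourhood of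
large blocks W = N x₁ = N x₂** ({x₁} and {x₂} are then two minimal admissible tuples for W).  In the paper's geometry
this is the generic situation: e.g. the 2d bonds at one point x carrying |(∂A)(b)| > p(ε) (with |A| ≤ p(ε)/(μ₀ε),
everything else small) have, away from the distance thresholds of the large-block grid, one and the same set of large
blocks within r(ε); every neighbourhood contains the element's own large block, so W ≠ ∅. [cite: Balaban1982Higgs2, (2.9) p.558] -/
theorem not_eq29Printed_of_two_sites {N : S → Finset β} {W : Finset β} {x₁ x₂ : S} (hx : x₁ ≠ x₂)
    (h₁ : N x₁ = W) (h₂ : N x₂ = W) (hW : W.Nonempty) : ¬Eq29Printed N W :=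
  not_eq29Printed_of_two_minimal (minimal_singleton h₁ hW) (minimal_singleton h₂ hW)
    (by rwa [Ne, Finset.singleton_inj])

/-- The smallest concrete instance of the failure: two elements, one large block, both elements r(ε)-close to it.
[cite: Balaban1982Higgs2, (2.9) p.558] -/
theorem not_eq29Printed_fin2 : ¬Eq29Printed (S := Fin 2) (fun _ => ({()} : Finset Unit)) {()} :=
  not_eq29Printed_of_two_sites (x₁ := 0) (x₂ := 1) (by decide) rfl rfl (Finset.singleton_nonempty _)

/-! ## (2.10): grouping (2.6) by Λ₀, the inequality that holds, and the failure of "=" as printed -/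

/-- The possible regions Λ₀^c: all values of (2.7) over the tuples (Σ_{Λ₀} in (2.10) ranges over these; any other Λ₀
has no admissible tuple). [cite: Balaban1982Higgs2, (2.10) p.558] -/
def regions (N : S → Finset β) : Finset (Finset β) := (Finset.univ : Finset (Finset S)).image (nbhd N)

/-- W = Λ₀^c(τ) is one of the regions. [cite: Balaban1982Higgs2, (2.10) p.558] -/
theorem nbhd_mem_regions (N : S → Finset β) (τ : Finset S) : nbhd N τ ∈ regions N :=
  Finset.mem_image.2 ⟨τ, Finset.mem_univ _, rfl⟩

/-- *"In (2.6) some terms have a set Λ₀ in common, so we can represent this sum as the sum over all possible sets Λ₀,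
and next for each fixed Λ₀ we have a sum over all admissible sets"*: Σ_{Λ₀} (left side of (2.9)) = the (2.6)-sum,
PROVED (grouping by the fibres of τ ↦ Λ₀^c(τ)). [cite: Balaban1982Higgs2, (2.10) p.558] -/
theorem sum_lhs29_eq_sum_term (N : S → Finset β) (c s : S → ℝ) :
    ∑ W ∈ regions N, lhs29 N W c s = ∑ τ, term c s τ := by
  have h := Finset.sum_fiberwise_of_maps_to (s := (Finset.univ : Finset (Finset S))) (t := regions N)
    (g := nbhd N) (fun τ _ => nbhd_mem_regions N τ) (term c s)
  simpa [lhs29, admissibles, Admissible] using h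

/-- Hence Σ_{Λ₀} (left side of (2.9)) = 1 for indicator weights with χ^c + χ = 1 — the content of (2.10) BEFORE the
resummation (2.9) is inserted; PROVED. [cite: Balaban1982Higgs2, (2.10) p.558] -/
theorem sum_lhs29_eq_one (N : S → Finset β) {c s : S → ℝ} (h1 : ∀ x, c x + s x = 1) :
    ∑ W ∈ regions N, lhs29 N W c s = 1 := by
  rw [sum_lhs29_eq_sum_term, sum_term_eq_one h1]

/-- **(2.10) AS PRINTED**: *"1 = Σ_{Λ₀} [the expression on the right side of (2.9)]"* for every field configuration.
REFUTED below together with (2.9); the true statements are `one_le_sum_rhs29` and `sum_rhs29_eq_one_of_subsingleton`.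
[cite: Balaban1982Higgs2, (2.10) p.558] -/
def Eq210Printed (N : S → Finset β) : Prop :=
  ∀ c s : S → ℝ, (∀ x, c x = 0 ∨ c x = 1) → (∀ x, c x + s x = 1) → (1 : ℝ) = ∑ W ∈ regions N, rhs29 N W c s

/-- **(2.10), REPAIRED READING (what the upper bound uses), PROVED**: 1 ≤ Σ_{Λ₀} [right side of (2.9)] for
non-negative indicator weights with χ^c + χ = 1. [cite: Balaban1982Higgs2, (2.10) p.558] -/
theorem one_le_sum_rhs29 (N : S → Finset β) {c s : S → ℝ} (hc : ∀ x, 0 ≤ c x) (hs : ∀ x, 0 ≤ s x)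
    (h1 : ∀ x, c x + s x = 1) : 1 ≤ ∑ W ∈ regions N, rhs29 N W c s := by
  rw [← sum_lhs29_eq_one N h1]
  exact Finset.sum_le_sum fun W _ => lhs29_le_rhs29 N W hc hs h1

/-- (2.10) holds with "=" when every region admits at most one minimal admissible tuple.
[cite: Balaban1982Higgs2, (2.10) p.558] -/
theorem sum_rhs29_eq_one_of_subsingleton (N : S → Finset β)
    (hsub : ∀ W m₁ m₂, Minimal (Admissible N W) m₁ → Minimal (Admissible N W) m₂ → m₁ = m₂) {c s : S → ℝ}
    (h1 : ∀ x, c x + s x = 1) : ∑ W ∈ regions N, rhs29 N W c s = 1 := by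
  rw [← sum_lhs29_eq_one N h1]
  exact Finset.sum_congr rfl fun W _ => (lhs29_eq_rhs29_of_subsingleton N W (hsub W) h1).symm

/-- **(2.10) AS PRINTED IS FALSE whenever some region admits two distinct minimal admissible tuples** (the strict
overcount of (2.9) at that region, `≤` at all others). [cite: Balaban1982Higgs2, (2.10) p.558] -/
theorem not_eq210Printed_of_two_minimal {N : S → Finset β} {W : Finset β} {m₁ m₂ : Finset S}
    (h₁ : Minimal (Admissible N W) m₁) (h₂ : Minimal (Admissible N W) m₂) (hne : m₁ ≠ m₂) :
    ¬Eq210Printed N := by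
  intro hEq
  set τ : Finset S := m₁ ∪ m₂ with hτdef
  have hτo : τ ⊆ outer N W := Finset.union_subset h₁.prop.subset_outer h₂.prop.subset_outer
  set c : S → ℝ := fun x => if x ∈ τ then 1 else 0 with hcdef
  set s : S → ℝ := fun x => if x ∈ τ then 0 else 1 with hsdef
  have hc01 : ∀ x, c x = 0 ∨ c x = 1 := fun x => by by_cases hx : x ∈ τ <;> simp [hcdef, hx]
  have hcs : ∀ x, c x + s x = 1 := fun x => by by_cases hx : x ∈ τ <;> simp [hcdef, hsdef, hx]
  have hc : ∀ x, 0 ≤ c x := fun x => by by_cases hx : x ∈ τ <;> simp [hcdef, hx]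
  have hs : ∀ x, 0 ≤ s x := fun x => by by_cases hx : x ∈ τ <;> simp [hsdef, hx]
  have hW : W ∈ regions N := by
    rw [← h₁.prop]
    exact nbhd_mem_regions N m₁
  have hlt : ∑ W' ∈ regions N, lhs29 N W' c s < ∑ W' ∈ regions N, rhs29 N W' c s :=
    Finset.sum_lt_sum (fun W' _ => lhs29_le_rhs29 N W' hc hs hcs)
      ⟨W, hW, lhs29_lt_rhs29 N W hc hs hcs hτo
        (two_le_count h₁ h₂ hne Finset.subset_union_left Finset.subset_union_right)
        (by rw [term_indicator_self]; exact one_pos)⟩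
  rw [sum_lhs29_eq_one N hcs] at hlt
  exact absurd (hEq c s hc01 hcs) (ne_of_lt hlt)

/-- (2.10) as printed fails under the two-sites hypothesis of `not_eq29Printed_of_two_sites`.
[cite: Balaban1982Higgs2, (2.10) p.558] -/
theorem not_eq210Printed_of_two_sites {N : S → Finset β} {W : Finset β} {x₁ x₂ : S} (hx : x₁ ≠ x₂)
    (h₁ : N x₁ = W) (h₂ : N x₂ = W) (hW : W.Nonempty) : ¬Eq210Printed N :=
  not_eq210Printed_of_two_minimal (minimal_singleton h₁ hW) (minimal_singleton h₂ hW)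
    (by rwa [Ne, Finset.singleton_inj])

/-! ## v1.1 (gen 3 append, unit `lit-balaban-r14`): (2.15) p. 559 — the object ζ_{Λ₀} as a sum over the minimal
admissible tuples of per-element factors (SKELETON row **B2.Eq2.15**, before: `absent`), and its kernel properties

THE SOURCE TEXT, verbatim (p. 559 [PDF 5], ×2 render p005).  *"From these estimates we get the following one
χ^c_{R_s} exp[−Σ_{x∈Λ₇^c}(λ(ε)|φ(x)|⁴ + ½δm²ε²|φ(x)|²)] ≤ exp(−½p(ε)⁴|R_s|)exp(O(ε^{κ₀})|Λ₇^c|) ≤ exp(−p(ε)²|R_s|)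
exp(O(ε^{κ₀})|Λ₇^c|). (2.13) … Let us denote
ζ_{Λ₀} = Σ_{{P_v,…,R_s} admissible, minimal for Λ₀} χ^c_{P_v}χ^c_{Q_v}χ^c_{R_v}χ^c_{P_s}χ^c_{Q_s} exp(−p(ε)²|R_s|). (2.15)"*
The same shape recurs at every scale: (3.34) p. 591 ζ′_{Λ₀^{(k)}} (with exp(−¼γ₀p(L^kε)²|Q_s^{(k)}|) replacing χ^c_{Q_s})
and (3.41) p. 592 ζ″_{Λ₀^{(k)}} (with moreover exp(−⅛ap(L^kε)²|P_s^{(k)}|) replacing χ^c_{P_s}), whose per-scale VALUE is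
the abstract carrier field `B2.Run.zeta` of Sect. 3.C.

DICTIONARY (continued).  `w x : ℝ` ↤ the factor carried by the element x of a minimal tuple: χ^c_x (a {0,1}-valued
indicator of the configuration) for x of the sorts P_v, Q_v, R_v, P_s, Q_s and the constant exp(−p(ε)²) for x of sort
R_s (so that Π_{x∈R_s} w x = exp(−p(ε)²|R_s|)); `isRs x` ↤ "x is of sort R_s"; `zetaW N W w` ↤ the sum over the
minimal admissible tuples of Π_{x∈τ} w x, `zeta215` ↤ (2.15) itself. -/

/-- The COMMON SHAPE of ζ_{Λ₀} (2.15), ζ′ (3.34), ζ″ (3.41): the sum over the minimal admissible tuples τ for W = Λ₀^c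
of the product of per-element factors w x, x ∈ τ. [cite: Balaban1982Higgs2, (2.15) p.559] -/
def zetaW (N : S → Finset β) (W : Finset β) (w : S → ℝ) : ℝ := ∑ τ ∈ minimals N W, ∏ x ∈ τ, w x

/-- **(2.15)** p. 559: ζ_{Λ₀} = Σ_{admissible, minimal for Λ₀} χ^c_{P_v}χ^c_{Q_v}χ^c_{R_v}χ^c_{P_s}χ^c_{Q_s}·exp(−p(ε)²|R_s|)
— the indicator χ^c_x is kept for the elements of the five sorts P_v, Q_v, R_v, P_s, Q_s and replaced by the small
factor exp(−p(ε)²) for each element of sort R_s (by (2.13)).  `c x` ↤ χ^c_x, `pε` ↤ p(ε), `isRs` ↤ the sort predicate.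
[cite: Balaban1982Higgs2, (2.15) p.559] -/
def zeta215 (N : S → Finset β) (W : Finset β) (isRs : S → Prop) (c : S → ℝ) (pε : ℝ) : ℝ :=
  zetaW N W fun x => if isRs x then Real.exp (-(pε ^ 2)) else c x

/-- Unfolding (definitional). [cite: Balaban1982Higgs2, (2.15) p.559] -/
theorem zetaW_def (N : S → Finset β) (W : Finset β) (w : S → ℝ) :
    zetaW N W w = ∑ τ ∈ minimals N W, ∏ x ∈ τ, w x := rfl

/-- Unfolding of (2.15) into the common shape. [cite: Balaban1982Higgs2, (2.15) p.559] -/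
theorem zeta215_eq (N : S → Finset β) (W : Finset β) (isRs : S → Prop) (c : S → ℝ) (pε : ℝ) :
    zeta215 N W isRs c pε = zetaW N W fun x => if isRs x then Real.exp (-(pε ^ 2)) else c x := rfl

omit [Fintype S] in
/-- On a minimal tuple τ the (2.15)-summand is (Π over the non-R_s elements of χ^c) · exp(−p(ε)²·#(R_s-elements of τ)),
i.e. the printed «χ^c_{P_v}…χ^c_{Q_s} exp(−p(ε)²|R_s|)». [cite: Balaban1982Higgs2, (2.15) p.559] -/
theorem prod_weight215 (isRs : S → Prop) (c : S → ℝ) (pε : ℝ) (τ : Finset S) :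
    ∏ x ∈ τ, (if isRs x then Real.exp (-(pε ^ 2)) else c x)
      = (∏ x ∈ τ.filter (fun x => ¬isRs x), c x) *
          Real.exp (-(pε ^ 2 * ((τ.filter isRs).card : ℝ))) := by
  rw [← Finset.prod_filter_mul_prod_filter_not τ isRs, mul_comm]
  congr 1
  · exact Finset.prod_congr rfl fun x hx => by simp [(Finset.mem_filter.1 hx).2]
  · rw [Finset.prod_congr rfl fun x hx => if_pos (Finset.mem_filter.1 hx).2, Finset.prod_const, ← Real.exp_nat_mul]
    congr 1
    ring

/-- ζ ≥ 0 for non-negative factors. [cite: Balaban1982Higgs2, (2.15) p.559] -/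
theorem zetaW_nonneg (N : S → Finset β) (W : Finset β) {w : S → ℝ} (hw : ∀ x, 0 ≤ w x) : 0 ≤ zetaW N W w :=
  Finset.sum_nonneg fun _ _ => Finset.prod_nonneg fun x _ => hw x

/-- ζ is monotone in the factors (this is how (2.13) turns χ^c_{R_s}·e^{−(interaction on R_s)} into exp(−p(ε)²|R_s|)
term by term, and how (3.31)/(3.33) produce ζ′, ζ″ from ζ). [cite: Balaban1982Higgs2, (2.15) p.559] -/
theorem zetaW_mono (N : S → Finset β) (W : Finset β) {w w' : S → ℝ} (hw : ∀ x, 0 ≤ w x) (hle : ∀ x, w x ≤ w' x) :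
    zetaW N W w ≤ zetaW N W w' :=
  Finset.sum_le_sum fun _ _ => Finset.prod_le_prod (fun x _ => hw x) fun x _ => hle x

/-- The right side of (2.9) FACTORS as ζ-shape × χ_{Λ_{−1}}: Σ_{minimal} Π_{x∈τ}χ^c_x · χ_{Λ_{−1}} = (zetaW with w = χ^c)
· Π_{x∈Λ_{−1}} χ_x — the form in which (2.15) enters (2.42)/(2.43). [cite: Balaban1982Higgs2, (2.15) p.559] -/
theorem rhs29_eq_zetaW_mul (N : S → Finset β) (W : Finset β) (c s : S → ℝ) :
    rhs29 N W c s = zetaW N W c * ∏ x ∈ inner N W, s x := by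
  rw [rhs29, zetaW, Finset.sum_mul]

/-- Minimal admissible tuples consist of elements of the outer region (at distance ≥ r(ε) from Λ₀; in particular
inside Λ₀^c). [cite: Balaban1982Higgs2, (2.15) p.559] -/
theorem minimals_subset_powerset_outer (N : S → Finset β) (W : Finset β) :
    minimals N W ⊆ (outer N W).powerset := fun _ hτ =>
  Finset.mem_powerset.2 (mem_minimals.1 hτ).prop.subset_outer

/-- Hence at most 2^{#outer} ≤ 2^{6|Λ₀^c|} minimal admissible tuples — the count used at (3.46) p. 593 (*"the number
of 6-tuples of subsets of Λ₀^{(k)c}"*). [cite: Balaban1982Higgs2, (2.15) p.559] -/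
theorem card_minimals_le (N : S → Finset β) (W : Finset β) :
    (minimals N W).card ≤ 2 ^ (outer N W).card := by
  calc (minimals N W).card ≤ ((outer N W).powerset).card := Finset.card_le_card (minimals_subset_powerset_outer N W)
    _ = 2 ^ (outer N W).card := Finset.card_powerset _

/-- The (3.46)-shape bound on a ζ: if every minimal tuple's product is ≤ B (B ≥ 0) then ζ ≤ 2^{#outer}·B (cf.
`B2Sect3C.ineq346` for ζ″). [cite: Balaban1982Higgs2, (2.15) p.559] -/
theorem zetaW_le_two_pow_mul (N : S → Finset β) (W : Finset β) {w : S → ℝ} {B : ℝ} (hB : 0 ≤ B)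
    (h : ∀ τ ∈ minimals N W, ∏ x ∈ τ, w x ≤ B) : zetaW N W w ≤ (2 : ℝ) ^ (outer N W).card * B := by
  calc zetaW N W w ≤ ∑ _τ ∈ minimals N W, B := Finset.sum_le_sum h
    _ = (minimals N W).card * B := by rw [Finset.sum_const, nsmul_eq_mul]
    _ ≤ (2 : ℝ) ^ (outer N W).card * B := by
        refine mul_le_mul_of_nonneg_right ?_ hB
        exact_mod_cast card_minimals_le N W

end

end Literature.MathematicalPhysics.QuantumFieldTheory.Balaban1983to89.B2Eq29Resummation
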